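import Literature.AnabelianGeometry.AbsoluteAnabelian.MLFGaloisElasticProofs
import Literature.AnabelianGeometry.AbsoluteAnabelian.FreeProcyclicStructure
import Literature.AnabelianGeometry.AbsoluteAnabelian.GaloisSubextensionProofs
import HarnessLib

/-!
# [AbsTopI] Thm 1.7 (i): a free procyclic group (`≅ Ẑ`) is neither elastic nor slim

S. Mochizuki, *Topics in Absolute Anabelian Geometry I: Generalities* (2012) [AbsTopI] (lit key
`paper:url-11ac98ba15fc`), Thm 1.7 (i) p. 14: "If `k` is an FF, then `G_k ≅ Ẑ` is neither elastic
nor slim." (print: "immediate from the definitions").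

THIS PROOF-ONLY FILE (no definitions, no named facts) proves the group-theoretic content for the
tree's interface predicate "`≅ Ẑ`" (`FundamentalExtension.IsFreeProcyclic`: a dense cyclic subgroup
and an open subgroup of every positive index), for any compact Hausdorff totally disconnected `G`:

* `not_isSlimGroup_of_isFreeProcyclic` — `G` is abelian (`mul_comm_of_dense_zpowers`) and
  nontrivial, so the centraliser of the open subgroup `G` is `G ≠ 1`;
* `not_isElastic_padicProd` — in `Ẑ = ∏_p ℤ_p` the factor `ℤ_2` is a topologically finitely
  generated closed (normal) subgroup which is neither trivial nor of finite index (the unit vector at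
  `3` has no positive multiple in it);
* `not_isElastic_of_isFreeProcyclic` — transport along the tree's structure theorem
  `IsFreeProcyclic.exists_continuousMulEquiv_padicProd` (`G ≃ₜ* ∏_p ℤ_p`) and
  `IsElastic.of_continuousMulEquiv`;
* `thm17i` — both clauses.

(The identification `G_k ≅ Ẑ` for a finite field `k` is the standard input under which this is the
printed (i); the tree applies the same interface e.g. to `G_F / galUnr` of an MLF.)  Classical;
nothing here bears on [IUTchIII] Cor. 3.12.
-/

noncomputable section

universe u

namespace Literature.AnabelianGeometry.AbsoluteAnabelian

open Literature.AlgebraicGeometry.Frobenioids (IsSlimGroup)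

/-! ### `Ẑ = ∏_p ℤ_p` is not elastic -/

/-- **`∏_p ℤ_p` is not elastic**: the `ℤ_2`-factor is a topologically finitely generated closed
normal subgroup of the open subgroup `⊤` which is neither trivial nor of finite index.
[cite: MochizukiAbsTopI2012, Thm 1.7 (i) p.14] -/
theorem not_isElastic_padicProd :
    ¬ IsElastic (Multiplicative (∀ p : Nat.Primes, @PadicInt (p : ℕ) ⟨p.2⟩)) := by
  classical
  intro h
  let P : Type := ∀ p : Nat.Primes, @PadicInt (p : ℕ) ⟨p.2⟩
  let G := Multiplicative P
  let two : Nat.Primes := ⟨2, Nat.prime_two⟩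
  let three : Nat.Primes := ⟨3, Nat.prime_three⟩
  have h23 : two ≠ three := by decide
  -- the `ℤ_2`-factor
  let N : Subgroup G :=
    { carrier := {x | ∀ p, p ≠ two → Multiplicative.toAdd x p = 0}
      one_mem' := fun p _ => rfl
      mul_mem' := by
        intro a b ha hb p hp
        simp only [Set.mem_setOf_eq] at ha hb ⊢
        rw [toAdd_mul, Pi.add_apply, ha p hp, hb p hp, add_zero]
      inv_mem' := by
        intro a ha p hp
        simp only [Set.mem_setOf_eq] at ha ⊢
        rw [toAdd_inv, Pi.neg_apply, ha p hp, neg_zero] }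
  have hNmem : ∀ x : G, x ∈ N ↔ ∀ p, p ≠ two → Multiplicative.toAdd x p = 0 := fun x => Iff.rfl
  have hTo : IsOpen (((⊤ : Subgroup G)) : Set G) := by
    rw [Subgroup.coe_top]; exact isOpen_univ
  have hNc : IsClosed (N : Set G) := by
    have : (N : Set G) = ⋂ p ∈ {p : Nat.Primes | p ≠ two},
        (fun x : G => Multiplicative.toAdd x p) ⁻¹' {0} := by
      ext x
      simp only [SetLike.mem_coe, hNmem, Set.mem_iInter, Set.mem_preimage, Set.mem_setOf_eq,
        Set.mem_singleton_iff]
    rw [this]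
    exact isClosed_biInter fun p _ =>
      isClosed_singleton.preimage ((continuous_apply p).comp continuous_toAdd)
  -- `ℤ_2 ↠ N`
  have hmemf : ∀ a : Multiplicative ℤ_[2],
      Multiplicative.ofAdd (Pi.single two (Multiplicative.toAdd a) : P) ∈ N := by
    intro a p hp
    change (Pi.single two (Multiplicative.toAdd a) : P) p = 0
    exact Pi.single_eq_of_ne hp _
  let f : Multiplicative ℤ_[2] →ₜ* N :=
    { toFun := fun a => ⟨Multiplicative.ofAdd (Pi.single two (Multiplicative.toAdd a) : P), hmemf a⟩
      map_one' := Subtype.ext (by simp)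
      map_mul' := fun a b => Subtype.ext (by
        simp only [toAdd_mul, Subgroup.coe_mul]
        rw [← ofAdd_add, ← Pi.single_add])
      continuous_toFun := by
        have hcs : Continuous fun x : ℤ_[2] => (Pi.single two x : P) :=
          continuous_single (A := fun j : Nat.Primes => @PadicInt (j : ℕ) ⟨j.2⟩) two
        exact (continuous_ofAdd.comp (hcs.comp continuous_toAdd)).subtype_mk hmemf }
  have hf : Function.Surjective f := by
    rintro ⟨y, hy⟩
    refine ⟨Multiplicative.ofAdd (Multiplicative.toAdd y two), Subtype.ext ?_⟩
    change Multiplicative.ofAdd (Pi.single two (Multiplicative.toAdd y two) : P) = y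
    rw [hNmem] at hy
    have : (Pi.single two (Multiplicative.toAdd y two) : P) = Multiplicative.toAdd y := by
      funext p
      by_cases hp : p = two
      · subst hp; simp
      · rw [Pi.single_eq_of_ne hp, hy p hp]
    rw [this, ofAdd_toAdd]
  -- `ℤ_2` is topologically finitely generated (`ℕ · 1` dense)
  have htfg2 : IsTopologicallyFinitelyGenerated (Multiplicative ℤ_[2]) := by
    refine ⟨{Multiplicative.ofAdd 1}, ?_⟩
    rw [eq_top_iff]
    intro x _
    rw [Finset.coe_singleton]
    have h1 : Set.range (fun n : ℕ => Multiplicative.ofAdd (n : ℤ_[2])) ⊆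
        ((Subgroup.closure ({Multiplicative.ofAdd (1 : ℤ_[2])} : Set (Multiplicative ℤ_[2]))) :
          Set (Multiplicative ℤ_[2])) := by
      rintro _ ⟨n, rfl⟩
      rw [SetLike.mem_coe, Subgroup.mem_closure_singleton]
      refine ⟨n, ?_⟩
      rw [zpow_natCast, ← ofAdd_nsmul, nsmul_eq_mul, mul_one]
    have h2 : DenseRange (fun n : ℕ => Multiplicative.ofAdd (n : ℤ_[2])) :=
      PadicInt.denseRange_natCast
    exact (h2.mono h1) x
  have hNfg : IsTopologicallyFinitelyGenerated N :=
    IsTopologicallyFinitelyGenerated.of_surjective f hf htfg2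
  haveI : (N.subgroupOf ⊤).Normal := inferInstance
  rcases h.eq_bot_or_finiteIndex ⊤ N hTo le_top inferInstance hNc hNfg with hbot | hfin
  · -- the unit vector at `2` lies in `N` and is not `1`
    have hmem : Multiplicative.ofAdd (Pi.single two (1 : ℤ_[2]) : P) ∈ N := by
      intro p hp
      change (Pi.single two (1 : ℤ_[2]) : P) p = 0
      exact Pi.single_eq_of_ne hp _
    rw [hbot, Subgroup.mem_bot] at hmem
    have h1 : (Pi.single two (1 : ℤ_[2]) : P) two = 0 := by
      have := congrArg Multiplicative.toAdd hmem
      rw [toAdd_ofAdd, toAdd_one] at this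
      rw [this]; rfl
    rw [Pi.single_eq_same] at h1
    exact one_ne_zero h1
  · -- the unit vector at `3` has no positive power in `N`
    obtain ⟨n, hn0, -, hn⟩ :=
      Subgroup.exists_pow_mem_of_index_ne_zero hfin.index_ne_zero
        (Multiplicative.ofAdd (Pi.single three (1 : ℤ_[3]) : P))
    rw [hNmem] at hn
    have h3 := hn three h23.symm
    rw [← ofAdd_nsmul, toAdd_ofAdd, Pi.smul_apply, Pi.single_eq_same, nsmul_eq_mul, mul_one] at h3
    have : (n : ℤ_[3]) = 0 := h3
    exact hn0.ne' (by exact_mod_cast this)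

/-! ### Thm 1.7 (i) for the interface `IsFreeProcyclic` -/

variable {G : Type u} [Group G] [TopologicalSpace G] [IsTopologicalGroup G] [CompactSpace G]
  [T2Space G] [TotallyDisconnectedSpace G]

/-- **A free procyclic group is not elastic** (transport of `not_isElastic_padicProd` along the
structure isomorphism `G ≃ₜ* ∏_p ℤ_p`). [cite: MochizukiAbsTopI2012, Thm 1.7 (i) p.14] -/
theorem not_isElastic_of_isFreeProcyclic (h : FundamentalExtension.IsFreeProcyclic G) :
    ¬ IsElastic G := by
  intro hG
  obtain ⟨e, -⟩ := h.exists_continuousMulEquiv_padicProd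
  exact not_isElastic_padicProd (IsElastic.of_continuousMulEquiv e.symm hG)

omit [CompactSpace G] [TotallyDisconnectedSpace G] in
/-- **A free procyclic group is not slim**: it is abelian and nontrivial, so the centraliser of the
open subgroup `G` itself is `G ≠ 1`. [cite: MochizukiAbsTopI2012, Thm 1.7 (i) p.14] -/
theorem not_isSlimGroup_of_isFreeProcyclic (h : FundamentalExtension.IsFreeProcyclic G) :
    ¬ IsSlimGroup G := by
  intro hs
  obtain ⟨g, hg⟩ := h.exists_dense_zpowers
  have htop := hs.centralizer_eq_bot ⊤ (by rw [Subgroup.coe_top]; exact isOpen_univ)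
  -- `G` is abelian, so the centraliser of `⊤` is `⊤`
  have hcent : Subgroup.centralizer ((⊤ : Subgroup G) : Set G) = ⊤ := by
    rw [eq_top_iff]
    intro x _
    rw [Subgroup.mem_centralizer_iff]
    intro y _
    exact mul_comm_of_dense_zpowers hg y x
  rw [hcent] at htop
  -- but `G` is nontrivial: it has an open subgroup of index `2`
  obtain ⟨H, -, hH⟩ := h.exists_isOpen_index 2 two_pos
  have hsub : Subsingleton G := by
    constructor
    intro a b
    have ha : a ∈ (⊤ : Subgroup G) := Subgroup.mem_top a
    have hb : b ∈ (⊤ : Subgroup G) := Subgroup.mem_top b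
    rw [htop, Subgroup.mem_bot] at ha hb
    rw [ha, hb]
  haveI := hsub
  have : H.index = 1 := by
    rw [Subgroup.index_eq_one]
    exact Subsingleton.elim _ _
  omega

/-- **[AbsTopI] Thm 1.7 (i)** for the interface "`≅ Ẑ`": a free procyclic compact Hausdorff totally
disconnected group is neither elastic nor slim. [cite: MochizukiAbsTopI2012, Thm 1.7 (i) p.14] -/
theorem thm17i (h : FundamentalExtension.IsFreeProcyclic G) : ¬ IsElastic G ∧ ¬ IsSlimGroup G :=
  ⟨not_isElastic_of_isFreeProcyclic h, not_isSlimGroup_of_isFreeProcyclic h⟩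

end Literature.AnabelianGeometry.AbsoluteAnabelian

end
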